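import Summits.QuantumFields.YangMills.Theorems.UnitScaleTiltProp7LinearCorrectorMember
import Summits.QuantumFields.YangMills.Theorems.UnitScaleTiltProp7HSOpNormSeam
import HarnessLib

/-!
# Route `UnitScaleTilt`, crux K1 «MinimiserStabilityRegPr» (stmt-QuantumFields-19200), route-R E′ path (α′), (E1-b) — THE CLOSE TEMPLATE: the door row `hL : p (L A) ≤ C_L·q A` of the exact-corrector
# contraction (✓p667460∕p672102, px13) from the TWO SUPPLIER ROWS IN THEIR OWN NATURAL SHAPES — the covariant (hK) row as routeR-w6 g6's (R-cov)∕(A-cov) chain delivers it (`√hs(D_𝒰(φ − φ_H)(x,μ)) ≤ κ·s₁` for every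
# pinned `Δ_𝒰`-biharmonic interpolant `φ_H` of `φ` and every `s₁ ≥ sup√hs(Δ_𝒰φ)`) and the covariant (hK₂) row as px11 g3's chain delivers it (px7's abstract-weight shape `w(x)·‖Δ_𝒰(φ − φ_H)(x)‖ ≤ C₂·ℓ·M`):
# the interpolant∕corrector instantiation (px13 ✓p671932), the `hs → ‖·‖` seam (✓p675290), the `Pi`-norm bookkeeping, and ✓p673081's door in ONE statement — so the final file is two `exact`s

Cell `ym3-torus`, D-0154 (3c) twin-width seat `ym-routeR-w3` (gen 6) = namer of the (hK)∕(A)∕(E1-b) lineage; LOCATE «(E1-b) CLOSE» (19200 evidence 7779e4954da6170d) §4; the cut with px11 (F4b∕F4c his, door letters mine;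
bus 2026-08-28T22:55Z).  THEOREMS ONLY (0 `def`, 0 `sorry`); `--supports stmt-QuantumFields-19200`, count-neutral.  YM₃ on T³ is a ladder rung (R3), not the Clay problem; nothing here claims the stub, the crux, d = 4 or the gap.

WHAT IS PROVED (ns `…Theorems.Prop7LinearCorrectorClose`; member letters: run `K` of a T³ family, level `K − n`, `SU(2)` background `W`, `𝒰 := fun κ z => unitsField (toUField W) ⟨z, κ⟩`, `T := torusT (F.P K) 0`,
`Δ_𝒰f x := divB T 𝒰 (fun μ => covD T 𝒰 μ f) x`, `ℓ := L^{K−n}`, `hs X := Σ_{jk}‖X j k‖²`, op norm = the E′ files' `L²`-operator norm, weight `w` real with `0 ≤ w x ≤ min(min_y tdist(x, embIter (K−n) y), ℓ)`).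
* `pi_norm_real_smul_le` — `(∀ x, w x·‖F x‖ ≤ B) → ‖fun x => (w x : ℂ) • F x‖ ≤ B` (`0 ≤ w`, `0 ≤ B`).
* ★★★ `linCorr_gauge_le_of_supplier_rows` — INPUTS: the two supplier rows `hKsup` (hs-currency, ∀ φ φ_H pinned-biharmonic, ∀ s₁) and `hK₂sup` (weight-currency, ∀ φ φ_H, ∀ M) AT THIS `W`, constants
  `κ, C₂ ≥ 0`; OUTPUT: `∃ I L`, px13's four characterisations, AND `∀ A, p_w (L A) ≤ max (3c_I∕2) (max c_I C₂)·q A` with `c_I := κ·√2∕ℓ`, for every gauge `p_w` of the knit's shape (`T₂ := T₂ʷ`) and every `q`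
  dominating `ℓ²‖D*_𝒰A‖_∞`.
HONEST SCOPE.  Bookkeeping; `hKsup`∕`hK₂sup` are DISPLAYED — their proofs are the (A-cov) instantiation (px22 over routeR-w6's transplant) and F4b∕F4c-cov (px11); when those land with these shapes the unconditional
close is two `exact`s.  Constants: the seam costs `√2`.

References: T. Bałaban, CMP 102 (1985) 277–309 [Balaban1985Variational] (Prop. 7 p.299); CMP 99 (1985) 75–102 [Balaban1985RegularSpaces] ((1.14) p.78, (1.36) p.82); CMP 99 (1985) 389–434
[Balaban1985BackgroundPropagators] ((3.3) p.390, (3.8) p.392).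
-/

set_option autoImplicit false

noncomputable section

open scoped BigOperators Matrix.Norms.L2Operator Matrix

namespace Summit.QuantumFields.YangMills.Theorems.Prop7LinearCorrectorClose

open Literature.MathematicalPhysics.QuantumFieldTheory.Balaban1983to89
open B9Eq39Adjoint (covD divB)
open B9TorusCalculus (torusT)
open B15DeterminingSets (embIter)
open B10Eq27TorusAxialLog (unitsField toUField)
open T3ContinuumYM3Torus (T3Family)
open Summit.QuantumFields.YangMills.Theorems.Prop7LinearCorrectorMember (exists_linCorr_member)
open Summit.QuantumFields.YangMills.Theorems.Prop7HSOpNormSeam (op_row_of_hs_row hs_bound_of_eq)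

/-- `Pi`-norm of a real-weighted field: `(∀ x, w x·‖F x‖ ≤ B) → ‖fun x => (w x : ℂ) • F x‖ ≤ B` for `0 ≤ w`, `0 ≤ B`. [folklore] -/
theorem pi_norm_real_smul_le {S : Type*} [Fintype S] {N : ℕ} (w : S → ℝ) (F : S → Matrix (Fin N) (Fin N) ℂ) {B : ℝ} (hB : 0 ≤ B)
    (hw0 : ∀ x, 0 ≤ w x) (h : ∀ x, w x * ‖F x‖ ≤ B) : ‖(fun x => ((w x : ℝ) : ℂ) • F x)‖ ≤ B := by
  refine (pi_norm_le_iff_of_nonneg hB).mpr fun x => ?_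
  rw [norm_smul, Complex.norm_real, Real.norm_of_nonneg (hw0 x)]
  exact h x

/-- ★★★ **THE (E1-b) CLOSE TEMPLATE.**  At an `SU(2)` background `W` of run `K`, level `K − n` (`ℓ = L^{K−n}`): IF the covariant (hK) row holds in routeR-w6's hs-currency (`hKsup`: for every `φ`, every `φ_H` agreeing with
`φ` at the centres and `Δ_𝒰`-biharmonic off them, every `s₁` with `√hs(Δ_𝒰φ z) ≤ s₁`: `√hs(D_𝒰(φ − φ_H)(x,μ)) ≤ κ·s₁`) AND the covariant (hK₂) row holds in px7∕px11's weight-currency (`hK₂sup`: same data, every `M`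
with `‖Δ_𝒰φ z‖ ≤ M`, every admissible weight `w`: `w x·‖Δ_𝒰(φ − φ_H) x‖ ≤ C₂·ℓ·M`), THEN for every admissible weight `w`, every gauge `p` of the knit's shape with `T₂ := T₂ʷ` and every size `q` dominating `ℓ²‖D*_𝒰A‖_∞`
there are `I, L` (px13's interpolant and corrector, characterised) with `∀ A, p (L A) ≤ max (3c_I∕2) (max c_I C₂)·q A`, `c_I := κ·√2∕ℓ` — the `hL` of ✓ `exists_unique_exact_corrector_gauge`.
[cite: Balaban1985Variational, Prop. 7 p.299; Balaban1985RegularSpaces, (1.36) p.82, (1.14) p.78; Balaban1985BackgroundPropagators, (3.3) p.390] -/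
theorem linCorr_gauge_le_of_supplier_rows (F : T3Family) (K n : ℕ) (W : GaugeField (F.P K) 0 (Matrix.specialUnitaryGroup (Fin 2) ℂ))
    -- the weight (any lower bound of the distance to the centres, capped at ℓ, nonnegative)
    (w : Site (F.P K) 0 → ℝ) (hwC : ∀ (x : Site (F.P K) 0) (y : Site (F.P K) (K - n)), w x ≤ (Site.tdist x (embIter (K - n) y) : ℝ))
    (hwℓ : ∀ x, w x ≤ (F.L : ℝ) ^ (K - n)) (hw0 : ∀ x, 0 ≤ w x)
    -- the gauge and the size
    (p : (Site (F.P K) 0 → Matrix (Fin 2) (Fin 2) ℂ) → ℝ)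
    (hp : ∀ ψ, p ψ = max ‖ψ‖ (max ((F.L : ℝ) ^ (K - n) * ‖(fun μ z => covD (torusT (F.P K) 0) (fun κ z => unitsField (toUField W) ⟨z, κ⟩) μ ψ z)‖)
      ((F.L : ℝ) ^ (K - n) * ‖(fun x => ((w x : ℝ) : ℂ) • divB (torusT (F.P K) 0) (fun κ z => unitsField (toUField W) ⟨z, κ⟩)
        (fun μ => covD (torusT (F.P K) 0) (fun κ z => unitsField (toUField W) ⟨z, κ⟩) μ ψ) x)‖)))
    (q : (Fin (F.P K).d → Site (F.P K) 0 → Matrix (Fin 2) (Fin 2) ℂ) → ℝ)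
    (hq : ∀ A, ((F.L : ℝ) ^ (K - n)) ^ 2 * ‖(fun x => divB (torusT (F.P K) 0) (fun κ z => unitsField (toUField W) ⟨z, κ⟩) A x)‖ ≤ q A)
    -- the two supplier rows
    {κ C₂ : ℝ} (hκ : 0 ≤ κ) (hC₂ : 0 ≤ C₂)
    (hKsup : ∀ (φ φH : Site (F.P K) 0 → Matrix (Fin 2) (Fin 2) ℂ),
      (∀ y : Site (F.P K) (K - n), φH (embIter (K - n) y) = φ (embIter (K - n) y)) →
      (∀ x : Site (F.P K) 0, x ∉ Set.range (embIter (K - n)) →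
        divB (torusT (F.P K) 0) (fun κ z => unitsField (toUField W) ⟨z, κ⟩)
          (fun μ => covD (torusT (F.P K) 0) (fun κ z => unitsField (toUField W) ⟨z, κ⟩) μ
            (fun y => divB (torusT (F.P K) 0) (fun κ z => unitsField (toUField W) ⟨z, κ⟩)
              (fun ν => covD (torusT (F.P K) 0) (fun κ z => unitsField (toUField W) ⟨z, κ⟩) ν φH) y)) x = 0) →
      ∀ s₁ : ℝ, (∀ z, Real.sqrt (∑ j : Fin 2, ∑ k : Fin 2,
        ‖(divB (torusT (F.P K) 0) (fun κ z => unitsField (toUField W) ⟨z, κ⟩)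
          (fun μ => covD (torusT (F.P K) 0) (fun κ z => unitsField (toUField W) ⟨z, κ⟩) μ φ) z) j k‖ ^ 2) ≤ s₁) →
      ∀ (μ : Fin (F.P K).d) (x : Site (F.P K) 0),
        Real.sqrt (∑ j : Fin 2, ∑ k : Fin 2, ‖(covD (torusT (F.P K) 0) (fun κ z => unitsField (toUField W) ⟨z, κ⟩) μ (fun y => φ y - φH y) x) j k‖ ^ 2) ≤ κ * s₁)
    (hK₂sup : ∀ (φ φH : Site (F.P K) 0 → Matrix (Fin 2) (Fin 2) ℂ),
      (∀ y : Site (F.P K) (K - n), φH (embIter (K - n) y) = φ (embIter (K - n) y)) →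
      (∀ x : Site (F.P K) 0, x ∉ Set.range (embIter (K - n)) →
        divB (torusT (F.P K) 0) (fun κ z => unitsField (toUField W) ⟨z, κ⟩)
          (fun μ => covD (torusT (F.P K) 0) (fun κ z => unitsField (toUField W) ⟨z, κ⟩) μ
            (fun y => divB (torusT (F.P K) 0) (fun κ z => unitsField (toUField W) ⟨z, κ⟩)
              (fun ν => covD (torusT (F.P K) 0) (fun κ z => unitsField (toUField W) ⟨z, κ⟩) ν φH) y)) x = 0) →
      ∀ M : ℝ, (∀ z, ‖divB (torusT (F.P K) 0) (fun κ z => unitsField (toUField W) ⟨z, κ⟩)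
          (fun μ => covD (torusT (F.P K) 0) (fun κ z => unitsField (toUField W) ⟨z, κ⟩) μ φ) z‖ ≤ M) →
      ∀ w' : Site (F.P K) 0 → ℝ, (∀ (x : Site (F.P K) 0) (y : Site (F.P K) (K - n)), w' x ≤ (Site.tdist x (embIter (K - n) y) : ℝ)) →
        (∀ x, w' x ≤ (F.L : ℝ) ^ (K - n)) → (∀ x, 0 ≤ w' x) →
      ∀ x : Site (F.P K) 0, w' x * ‖divB (torusT (F.P K) 0) (fun κ z => unitsField (toUField W) ⟨z, κ⟩)
          (fun μ => covD (torusT (F.P K) 0) (fun κ z => unitsField (toUField W) ⟨z, κ⟩) μ (fun y => φ y - φH y)) x‖ ≤ C₂ * (F.L : ℝ) ^ (K - n) * M) :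
    ∃ (I : (Site (F.P K) 0 → Matrix (Fin 2) (Fin 2) ℂ) →+ (Site (F.P K) 0 → Matrix (Fin 2) (Fin 2) ℂ))
      (L : (Fin (F.P K).d → Site (F.P K) 0 → Matrix (Fin 2) (Fin 2) ℂ) →+ (Site (F.P K) 0 → Matrix (Fin 2) (Fin 2) ℂ)),
      (∀ A φ, (∀ x, divB (torusT (F.P K) 0) (fun κ z => unitsField (toUField W) ⟨z, κ⟩)
            (fun μ => covD (torusT (F.P K) 0) (fun κ z => unitsField (toUField W) ⟨z, κ⟩) μ φ) x
          = divB (torusT (F.P K) 0) (fun κ z => unitsField (toUField W) ⟨z, κ⟩) A x) → L A = φ - I φ) ∧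
      (∀ (A) (y : Site (F.P K) (K - n)), L A (embIter (K - n) y) = 0) ∧
      ∀ A, p (L A) ≤ max (3 / 2 * (κ * Real.sqrt 2 / (F.L : ℝ) ^ (K - n))) (max (κ * Real.sqrt 2 / (F.L : ℝ) ^ (K - n)) C₂) * q A := by
  -- letters
  set 𝒰 : Fin (F.P K).d → Site (F.P K) 0 → (Matrix (Fin 2) (Fin 2) ℂ)ˣ := fun κ z => unitsField (toUField W) ⟨z, κ⟩ with h𝒰
  set ℓ : ℝ := (F.L : ℝ) ^ (K - n) with hℓ
  have hL0 : (0 : ℝ) < (F.L : ℝ) := Nat.cast_pos.mpr (by have := F.hL.2; omega)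
  have hℓ0 : 0 < ℓ := pow_pos hL0 _
  -- the door at the member, with `T₂ := T₂ʷ`
  obtain ⟨I, L, hI, hLφ, hLC, hsolv, hdoor⟩ := exists_linCorr_member F K n W
    (fun ψ => fun x => ((w x : ℝ) : ℂ) • divB (torusT (F.P K) 0) 𝒰 (fun μ => covD (torusT (F.P K) 0) 𝒰 μ ψ) x) p hp q hq
  refine ⟨I, L, hLφ, hLC, ?_⟩
  have hcI : 0 ≤ κ * Real.sqrt 2 / ℓ := div_nonneg (mul_nonneg hκ (Real.sqrt_nonneg _)) hℓ0.le
  refine hdoor (κ * Real.sqrt 2 / ℓ) C₂ hcI hC₂ ?_ ?_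
  · -- (hK) for `L`: instantiate the supplier at `φ`, `φ_H := I φ`, `s₁ := √2·‖D*A‖_∞`, then the seam
    intro A μ x
    obtain ⟨φ, hφ, hLA⟩ := hsolv A
    have hH : ∀ y : Site (F.P K) (K - n), I φ (embIter (K - n) y) = φ (embIter (K - n) y) := (hI φ).1.1
    have hEL := (hI φ).1.2
    set G : Site (F.P K) 0 → Matrix (Fin 2) (Fin 2) ℂ := fun x => divB (torusT (F.P K) 0) 𝒰 A x with hG
    have hs₁ : ∀ z, Real.sqrt (∑ j : Fin 2, ∑ k : Fin 2,
        ‖(divB (torusT (F.P K) 0) 𝒰 (fun μ => covD (torusT (F.P K) 0) 𝒰 μ φ) z) j k‖ ^ 2) ≤ Real.sqrt (2 : ℕ) * ‖G‖ :=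
      hs_bound_of_eq (fun z => divB (torusT (F.P K) 0) 𝒰 (fun μ => covD (torusT (F.P K) 0) 𝒰 μ φ) z) G hφ
    have hrow := hKsup φ (I φ) hH hEL (Real.sqrt (2 : ℕ) * ‖G‖) hs₁
    have hLA' : L A = fun y => φ y - I φ y := by rw [hLA]; rfl
    have hop := op_row_of_hs_row (torusT (F.P K) 0) 𝒰 (fun y => φ y - I φ y) G hrow μ x
    rw [hLA']
    calc ‖covD (torusT (F.P K) 0) 𝒰 μ (fun y => φ y - I φ y) x‖ ≤ κ * Real.sqrt (2 : ℕ) * ‖G‖ := hop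
      _ = κ * Real.sqrt 2 / ℓ * ℓ * ‖G‖ := by
          have : (((2 : ℕ) : ℝ)) = 2 := by norm_num
          rw [this]; field_simp
  · -- (hK₂) for `L`: instantiate the supplier at `φ`, `φ_H := I φ`, `M := ‖D*A‖_∞`, weight `w`, then the `Pi` norm
    intro A
    obtain ⟨φ, hφ, hLA⟩ := hsolv A
    have hH : ∀ y : Site (F.P K) (K - n), I φ (embIter (K - n) y) = φ (embIter (K - n) y) := (hI φ).1.1
    have hEL := (hI φ).1.2
    set G : Site (F.P K) 0 → Matrix (Fin 2) (Fin 2) ℂ := fun x => divB (torusT (F.P K) 0) 𝒰 A x with hG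
    have hM : ∀ z, ‖divB (torusT (F.P K) 0) 𝒰 (fun μ => covD (torusT (F.P K) 0) 𝒰 μ φ) z‖ ≤ ‖G‖ := fun z => by
      rw [hφ z]; exact norm_le_pi_norm G z
    have hrow := hK₂sup φ (I φ) hH hEL ‖G‖ hM w hwC hwℓ hw0
    have hLA' : L A = fun y => φ y - I φ y := by rw [hLA]; rfl
    rw [hLA']
    have hB : 0 ≤ C₂ * ℓ * ‖G‖ := by positivity
    exact pi_norm_real_smul_le w _ hB hw0 hrow

/-- ★★★ **THE (E1-b) CLOSE TEMPLATE WITH THE CHARACTERISATION EXPORTED** (v1.1, ym3-torus-px13 g4 for the (E1)-door ✓ `Prop7PinnedSliceRowOfThm2Datum`): ✓ `linCorr_gauge_le_of_supplier_rows`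
VERBATIM (same hypotheses, same proof) whose conclusion ALSO exports ✓ `exists_linCorr_member`'s (I)-characterisation (pinned biharmonic interpolant incl. uniqueness) and the solvability
clause — the four conjuncts the (E1-e) socket ✓ `Prop7PinnedSliceOfLinCorrRow.pinnedSlice_member_of_linCorrRow`'s `hLrow` reads (px13 g3 SOCKET NOTE: without them the export is inhabited by `I := id, L := 0`).
[cite: Balaban1985Variational, Prop. 7 p.299; Balaban1985RegularSpaces, (1.36) p.82, (1.14) p.78; Balaban1985BackgroundPropagators, (3.3) p.390] -/
theorem linCorr_gauge_le_of_supplier_rows_char (F : T3Family) (K n : ℕ) (W : GaugeField (F.P K) 0 (Matrix.specialUnitaryGroup (Fin 2) ℂ))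
    -- the weight (any lower bound of the distance to the centres, capped at ℓ, nonnegative)
    (w : Site (F.P K) 0 → ℝ) (hwC : ∀ (x : Site (F.P K) 0) (y : Site (F.P K) (K - n)), w x ≤ (Site.tdist x (embIter (K - n) y) : ℝ))
    (hwℓ : ∀ x, w x ≤ (F.L : ℝ) ^ (K - n)) (hw0 : ∀ x, 0 ≤ w x)
    -- the gauge and the size
    (p : (Site (F.P K) 0 → Matrix (Fin 2) (Fin 2) ℂ) → ℝ)
    (hp : ∀ ψ, p ψ = max ‖ψ‖ (max ((F.L : ℝ) ^ (K - n) * ‖(fun μ z => covD (torusT (F.P K) 0) (fun κ z => unitsField (toUField W) ⟨z, κ⟩) μ ψ z)‖)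
      ((F.L : ℝ) ^ (K - n) * ‖(fun x => ((w x : ℝ) : ℂ) • divB (torusT (F.P K) 0) (fun κ z => unitsField (toUField W) ⟨z, κ⟩)
        (fun μ => covD (torusT (F.P K) 0) (fun κ z => unitsField (toUField W) ⟨z, κ⟩) μ ψ) x)‖)))
    (q : (Fin (F.P K).d → Site (F.P K) 0 → Matrix (Fin 2) (Fin 2) ℂ) → ℝ)
    (hq : ∀ A, ((F.L : ℝ) ^ (K - n)) ^ 2 * ‖(fun x => divB (torusT (F.P K) 0) (fun κ z => unitsField (toUField W) ⟨z, κ⟩) A x)‖ ≤ q A)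
    -- the two supplier rows
    {κ C₂ : ℝ} (hκ : 0 ≤ κ) (hC₂ : 0 ≤ C₂)
    (hKsup : ∀ (φ φH : Site (F.P K) 0 → Matrix (Fin 2) (Fin 2) ℂ),
      (∀ y : Site (F.P K) (K - n), φH (embIter (K - n) y) = φ (embIter (K - n) y)) →
      (∀ x : Site (F.P K) 0, x ∉ Set.range (embIter (K - n)) →
        divB (torusT (F.P K) 0) (fun κ z => unitsField (toUField W) ⟨z, κ⟩)
          (fun μ => covD (torusT (F.P K) 0) (fun κ z => unitsField (toUField W) ⟨z, κ⟩) μ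
            (fun y => divB (torusT (F.P K) 0) (fun κ z => unitsField (toUField W) ⟨z, κ⟩)
              (fun ν => covD (torusT (F.P K) 0) (fun κ z => unitsField (toUField W) ⟨z, κ⟩) ν φH) y)) x = 0) →
      ∀ s₁ : ℝ, (∀ z, Real.sqrt (∑ j : Fin 2, ∑ k : Fin 2,
        ‖(divB (torusT (F.P K) 0) (fun κ z => unitsField (toUField W) ⟨z, κ⟩)
          (fun μ => covD (torusT (F.P K) 0) (fun κ z => unitsField (toUField W) ⟨z, κ⟩) μ φ) z) j k‖ ^ 2) ≤ s₁) →
      ∀ (μ : Fin (F.P K).d) (x : Site (F.P K) 0),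
        Real.sqrt (∑ j : Fin 2, ∑ k : Fin 2, ‖(covD (torusT (F.P K) 0) (fun κ z => unitsField (toUField W) ⟨z, κ⟩) μ (fun y => φ y - φH y) x) j k‖ ^ 2) ≤ κ * s₁)
    (hK₂sup : ∀ (φ φH : Site (F.P K) 0 → Matrix (Fin 2) (Fin 2) ℂ),
      (∀ y : Site (F.P K) (K - n), φH (embIter (K - n) y) = φ (embIter (K - n) y)) →
      (∀ x : Site (F.P K) 0, x ∉ Set.range (embIter (K - n)) →
        divB (torusT (F.P K) 0) (fun κ z => unitsField (toUField W) ⟨z, κ⟩)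
          (fun μ => covD (torusT (F.P K) 0) (fun κ z => unitsField (toUField W) ⟨z, κ⟩) μ
            (fun y => divB (torusT (F.P K) 0) (fun κ z => unitsField (toUField W) ⟨z, κ⟩)
              (fun ν => covD (torusT (F.P K) 0) (fun κ z => unitsField (toUField W) ⟨z, κ⟩) ν φH) y)) x = 0) →
      ∀ M : ℝ, (∀ z, ‖divB (torusT (F.P K) 0) (fun κ z => unitsField (toUField W) ⟨z, κ⟩)
          (fun μ => covD (torusT (F.P K) 0) (fun κ z => unitsField (toUField W) ⟨z, κ⟩) μ φ) z‖ ≤ M) →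
      ∀ w' : Site (F.P K) 0 → ℝ, (∀ (x : Site (F.P K) 0) (y : Site (F.P K) (K - n)), w' x ≤ (Site.tdist x (embIter (K - n) y) : ℝ)) →
        (∀ x, w' x ≤ (F.L : ℝ) ^ (K - n)) → (∀ x, 0 ≤ w' x) →
      ∀ x : Site (F.P K) 0, w' x * ‖divB (torusT (F.P K) 0) (fun κ z => unitsField (toUField W) ⟨z, κ⟩)
          (fun μ => covD (torusT (F.P K) 0) (fun κ z => unitsField (toUField W) ⟨z, κ⟩) μ (fun y => φ y - φH y)) x‖ ≤ C₂ * (F.L : ℝ) ^ (K - n) * M) :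
    ∃ (I : (Site (F.P K) 0 → Matrix (Fin 2) (Fin 2) ℂ) →+ (Site (F.P K) 0 → Matrix (Fin 2) (Fin 2) ℂ))
      (L : (Fin (F.P K).d → Site (F.P K) 0 → Matrix (Fin 2) (Fin 2) ℂ) →+ (Site (F.P K) 0 → Matrix (Fin 2) (Fin 2) ℂ)),
      -- (I) the pinned `Δ_W`-biharmonic interpolant, characterised (✓ `exists_linCorr_member`'s export VERBATIM)
      (∀ φ, ((∀ y : Site (F.P K) (K - n), I φ (embIter (K - n) y) = φ (embIter (K - n) y)) ∧
          ∀ x : Site (F.P K) 0, x ∉ Set.range (embIter (K - n)) →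
            divB (torusT (F.P K) 0) (fun κ z => unitsField (toUField W) ⟨z, κ⟩)
              (fun μ => covD (torusT (F.P K) 0) (fun κ z => unitsField (toUField W) ⟨z, κ⟩) μ
                (fun y => divB (torusT (F.P K) 0) (fun κ z => unitsField (toUField W) ⟨z, κ⟩)
                  (fun ν => covD (torusT (F.P K) 0) (fun κ z => unitsField (toUField W) ⟨z, κ⟩) ν (I φ)) y)) x = 0) ∧
        ∀ χ, (∀ y : Site (F.P K) (K - n), χ (embIter (K - n) y) = φ (embIter (K - n) y)) →
          (∀ x : Site (F.P K) 0, x ∉ Set.range (embIter (K - n)) →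
            divB (torusT (F.P K) 0) (fun κ z => unitsField (toUField W) ⟨z, κ⟩)
              (fun μ => covD (torusT (F.P K) 0) (fun κ z => unitsField (toUField W) ⟨z, κ⟩) μ
                (fun y => divB (torusT (F.P K) 0) (fun κ z => unitsField (toUField W) ⟨z, κ⟩)
                  (fun ν => covD (torusT (F.P K) 0) (fun κ z => unitsField (toUField W) ⟨z, κ⟩) ν χ) y)) x = 0) → χ = I φ) ∧
      -- (L) the corrector for every potential
      (∀ A φ, (∀ x, divB (torusT (F.P K) 0) (fun κ z => unitsField (toUField W) ⟨z, κ⟩)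
            (fun μ => covD (torusT (F.P K) 0) (fun κ z => unitsField (toUField W) ⟨z, κ⟩) μ φ) x
          = divB (torusT (F.P K) 0) (fun κ z => unitsField (toUField W) ⟨z, κ⟩) A x) → L A = φ - I φ) ∧
      -- pinning
      (∀ (A) (y : Site (F.P K) (K - n)), L A (embIter (K - n) y) = 0) ∧
      -- solvability
      (∀ A, ∃ φ, (∀ x, divB (torusT (F.P K) 0) (fun κ z => unitsField (toUField W) ⟨z, κ⟩)
            (fun μ => covD (torusT (F.P K) 0) (fun κ z => unitsField (toUField W) ⟨z, κ⟩) μ φ) x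
          = divB (torusT (F.P K) 0) (fun κ z => unitsField (toUField W) ⟨z, κ⟩) A x) ∧ L A = φ - I φ) ∧
      ∀ A, p (L A) ≤ max (3 / 2 * (κ * Real.sqrt 2 / (F.L : ℝ) ^ (K - n))) (max (κ * Real.sqrt 2 / (F.L : ℝ) ^ (K - n)) C₂) * q A := by
  -- letters
  set 𝒰 : Fin (F.P K).d → Site (F.P K) 0 → (Matrix (Fin 2) (Fin 2) ℂ)ˣ := fun κ z => unitsField (toUField W) ⟨z, κ⟩ with h𝒰
  set ℓ : ℝ := (F.L : ℝ) ^ (K - n) with hℓ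
  have hL0 : (0 : ℝ) < (F.L : ℝ) := Nat.cast_pos.mpr (by have := F.hL.2; omega)
  have hℓ0 : 0 < ℓ := pow_pos hL0 _
  -- the door at the member, with `T₂ := T₂ʷ`
  obtain ⟨I, L, hI, hLφ, hLC, hsolv, hdoor⟩ := exists_linCorr_member F K n W
    (fun ψ => fun x => ((w x : ℝ) : ℂ) • divB (torusT (F.P K) 0) 𝒰 (fun μ => covD (torusT (F.P K) 0) 𝒰 μ ψ) x) p hp q hq
  refine ⟨I, L, hI, hLφ, hLC, hsolv, ?_⟩
  have hcI : 0 ≤ κ * Real.sqrt 2 / ℓ := div_nonneg (mul_nonneg hκ (Real.sqrt_nonneg _)) hℓ0.le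
  refine hdoor (κ * Real.sqrt 2 / ℓ) C₂ hcI hC₂ ?_ ?_
  · -- (hK) for `L`: instantiate the supplier at `φ`, `φ_H := I φ`, `s₁ := √2·‖D*A‖_∞`, then the seam
    intro A μ x
    obtain ⟨φ, hφ, hLA⟩ := hsolv A
    have hH : ∀ y : Site (F.P K) (K - n), I φ (embIter (K - n) y) = φ (embIter (K - n) y) := (hI φ).1.1
    have hEL := (hI φ).1.2
    set G : Site (F.P K) 0 → Matrix (Fin 2) (Fin 2) ℂ := fun x => divB (torusT (F.P K) 0) 𝒰 A x with hG
    have hs₁ : ∀ z, Real.sqrt (∑ j : Fin 2, ∑ k : Fin 2,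
        ‖(divB (torusT (F.P K) 0) 𝒰 (fun μ => covD (torusT (F.P K) 0) 𝒰 μ φ) z) j k‖ ^ 2) ≤ Real.sqrt (2 : ℕ) * ‖G‖ :=
      hs_bound_of_eq (fun z => divB (torusT (F.P K) 0) 𝒰 (fun μ => covD (torusT (F.P K) 0) 𝒰 μ φ) z) G hφ
    have hrow := hKsup φ (I φ) hH hEL (Real.sqrt (2 : ℕ) * ‖G‖) hs₁
    have hLA' : L A = fun y => φ y - I φ y := by rw [hLA]; rfl
    have hop := op_row_of_hs_row (torusT (F.P K) 0) 𝒰 (fun y => φ y - I φ y) G hrow μ x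
    rw [hLA']
    calc ‖covD (torusT (F.P K) 0) 𝒰 μ (fun y => φ y - I φ y) x‖ ≤ κ * Real.sqrt (2 : ℕ) * ‖G‖ := hop
      _ = κ * Real.sqrt 2 / ℓ * ℓ * ‖G‖ := by
          have : (((2 : ℕ) : ℝ)) = 2 := by norm_num
          rw [this]; field_simp
  · -- (hK₂) for `L`: instantiate the supplier at `φ`, `φ_H := I φ`, `M := ‖D*A‖_∞`, weight `w`, then the `Pi` norm
    intro A
    obtain ⟨φ, hφ, hLA⟩ := hsolv A
    have hH : ∀ y : Site (F.P K) (K - n), I φ (embIter (K - n) y) = φ (embIter (K - n) y) := (hI φ).1.1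
    have hEL := (hI φ).1.2
    set G : Site (F.P K) 0 → Matrix (Fin 2) (Fin 2) ℂ := fun x => divB (torusT (F.P K) 0) 𝒰 A x with hG
    have hM : ∀ z, ‖divB (torusT (F.P K) 0) 𝒰 (fun μ => covD (torusT (F.P K) 0) 𝒰 μ φ) z‖ ≤ ‖G‖ := fun z => by
      rw [hφ z]; exact norm_le_pi_norm G z
    have hrow := hK₂sup φ (I φ) hH hEL ‖G‖ hM w hwC hwℓ hw0
    have hLA' : L A = fun y => φ y - I φ y := by rw [hLA]; rfl
    rw [hLA']
    have hB : 0 ≤ C₂ * ℓ * ‖G‖ := by positivity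
    exact pi_norm_real_smul_le w _ hB hw0 hrow

end Summit.QuantumFields.YangMills.Theorems.Prop7LinearCorrectorClose

end
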